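/-
Copyright: rh-split cell (screw, bridge) gen 19, 2026-08-28.  Splitting search over kernel-typed
RH-equivalences.  A splitting `A ∧ B ⟹ RH` is CONDITIONAL bookkeeping unless `A` and `B` are both
proved; nothing here bears on the truth of RH.
-/
import Summits.RiemannHypothesis.RiemannHypothesis.Theorems.Splittings.SlidingGermB

/-!
# «SLIDING GERM» — part C of 3 (canonical module): finite sums and the abstract COUNT THEFT LAW

* §5 finite sums: bounded slides change the window trace by at most
  `η̄·[(9/10)t⁴·Σ_{γ_k t ≤ 2/3} γ_k + 40t·Σ_{γ_k t > 2/3} γ_k⁻²]` (`abs_sum_slide_le`); unresolved atoms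
  (`‖κ_j‖|t| ≤ 1`) contribute between `(43/24)t²·Σ m_j` and `(53/24)t²·Σ m_j` (`sum_quadTerm_ge/le`);
  removed on-line pairs contribute between `(11/12)t²·Σ_{γ_r t ≤ 1} n_r` and
  `t²·Σ_{γ_r t ≤ 1} n_r + 4·Σ_{γ_r t > 1} n_r/γ_r²` (`sum_removed_ge/le`).
* §6 the abstract COUNT THEFT LAW (`count_theft_law`): on a germ window `(0, δ]`, (G1) + (G2) + the removal
  bound + the exact theft identity force `L·N(Y) ≤ R(Y) + K·η̄·log Y + C + D` at every height `Y ≥ 1/δ`;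
  corollary `no_superlog_tower_of_pure_sliding`: with no removal and `L > 0`, `N(Y)/log Y → ∞` is
  impossible (theory-1's (c1), modulo the SUMMED layer — (G1) over `Config`, (G2) over the true ordinates
  against `N(T) ≪ T log T` — which is NOT in this file and is named for the next seat).

HONEST LABEL: finite-sum bookkeeping and one division by `t²`; an INSTRUMENT for another seat's
conjecture; RH-free; toward RH: 0.  Nothing here bears on the truth of RH.
-/

set_option linter.dupNamespace false

namespace Summit.RiemannHypothesis.RiemannHypothesis.Theorems.Splittings.SlidingGerm

open Summit.RiemannHypothesis.RiemannHypothesis.Theorems.Splittings.ScrewLatticeWolff (quadTerm)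

/-! ## 5. Finite sums: slides, unresolved atoms, removed pairs -/

section finite

variable {ι : Type*}

/-- The termwise slide bound in the form used for summation: `|Δg_k| ≤ η̄ · b_k` with
`b_k = (9/10)γ_k t⁴` on the near set `γ_k t ≤ 2/3` and `b_k = 40t/γ_k²` on the far set. -/
theorem abs_slide_le_ite {γ η t ηbar : ℝ} (hγ : 0 < γ) (hηγ : |η| ≤ γ / 2) (hη : |η| ≤ ηbar)
    (ht : 0 ≤ t) :
    |pairTrace (γ + η) t - pairTrace γ t| ≤
      ηbar * (if γ * t ≤ 2 / 3 then 9 / 10 * γ * t ^ 4 else 40 * t / γ ^ 2) := by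
  split_ifs with hnear
  · calc |pairTrace (γ + η) t - pairTrace γ t| ≤ 9 / 10 * γ * t ^ 4 * |η| :=
          abs_slide_le_near hγ hηγ ht hnear
      _ ≤ 9 / 10 * γ * t ^ 4 * ηbar := by gcongr
      _ = ηbar * (9 / 10 * γ * t ^ 4) := by ring
  · calc |pairTrace (γ + η) t - pairTrace γ t| ≤ 40 * t / γ ^ 2 * |η| :=
          abs_slide_le_far hγ hηγ ht
      _ ≤ 40 * t / γ ^ 2 * ηbar := by gcongr
      _ = ηbar * (40 * t / γ ^ 2) := by ring

/-- **(G2), finite form.**  A finite family of bounded slides (`|η_k| ≤ η̄`, `|η_k| ≤ γ_k/2`) changes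
the window trace by at most `η̄·[(9/10)t⁴·Σ_{γ_k t ≤ 2/3} γ_k + 40t·Σ_{γ_k t > 2/3} γ_k⁻²]` — the near
ordinates enter with weight `γ_k t⁴` (NOT `t²`), the far ones with `t/γ_k²`. -/
theorem abs_sum_slide_le (s : Finset ι) (γ η : ι → ℝ) {t ηbar : ℝ} (ht : 0 ≤ t)
    (hγ : ∀ k ∈ s, 0 < γ k) (hηγ : ∀ k ∈ s, |η k| ≤ γ k / 2) (hη : ∀ k ∈ s, |η k| ≤ ηbar) :
    |∑ k ∈ s, (pairTrace (γ k + η k) t - pairTrace (γ k) t)| ≤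
      ηbar * (9 / 10 * t ^ 4 * ∑ k ∈ s with γ k * t ≤ 2 / 3, γ k
               + 40 * t * ∑ k ∈ s with ¬ γ k * t ≤ 2 / 3, 1 / γ k ^ 2) := by
  calc |∑ k ∈ s, (pairTrace (γ k + η k) t - pairTrace (γ k) t)|
      ≤ ∑ k ∈ s, |pairTrace (γ k + η k) t - pairTrace (γ k) t| := Finset.abs_sum_le_sum_abs _ _
    _ ≤ ∑ k ∈ s, ηbar * (if γ k * t ≤ 2 / 3 then 9 / 10 * γ k * t ^ 4 else 40 * t / γ k ^ 2) :=
        Finset.sum_le_sum fun k hk ↦ abs_slide_le_ite (hγ k hk) (hηγ k hk) (hη k hk) ht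
    _ = ηbar * (9 / 10 * t ^ 4 * ∑ k ∈ s with γ k * t ≤ 2 / 3, γ k
               + 40 * t * ∑ k ∈ s with ¬ γ k * t ≤ 2 / 3, 1 / γ k ^ 2) := by
        rw [← Finset.mul_sum, Finset.sum_ite, Finset.mul_sum, Finset.mul_sum]
        congr 1
        congr 1
        · exact Finset.sum_congr rfl fun k _ ↦ by ring
        · exact Finset.sum_congr rfl fun k _ ↦ by ring

/-- **(G1), finite form, unresolved atoms.**  Atoms with `‖κ_j‖·|t| ≤ 1` jointly contribute at least
`(43/24)·t²·Σ_j m_j` to the window trace. -/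
theorem sum_quadTerm_ge (s : Finset ι) (m : ι → ℝ) (κ : ι → ℂ) {t : ℝ} (hm : ∀ j ∈ s, 0 ≤ m j)
    (hκ : ∀ j ∈ s, κ j ≠ 0) (h : ∀ j ∈ s, ‖κ j‖ * |t| ≤ 1) :
    43 / 24 * t ^ 2 * ∑ j ∈ s, m j ≤ ∑ j ∈ s, quadTerm (m j) (κ j) t := by
  rw [Finset.mul_sum]
  refine Finset.sum_le_sum fun j hj ↦ ?_
  have := (quadTerm_germ_bounds (hm j hj) (hκ j hj) (h j hj)).1
  linarith

/-- Unresolved atoms, upper side: at most `(53/24)·t²·Σ_j m_j`. -/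
theorem sum_quadTerm_le (s : Finset ι) (m : ι → ℝ) (κ : ι → ℂ) {t : ℝ} (hm : ∀ j ∈ s, 0 ≤ m j)
    (hκ : ∀ j ∈ s, κ j ≠ 0) (h : ∀ j ∈ s, ‖κ j‖ * |t| ≤ 1) :
    ∑ j ∈ s, quadTerm (m j) (κ j) t ≤ 53 / 24 * t ^ 2 * ∑ j ∈ s, m j := by
  rw [Finset.mul_sum]
  refine Finset.sum_le_sum fun j hj ↦ ?_
  have := (quadTerm_germ_bounds (hm j hj) (hκ j hj) (h j hj)).2
  linarith

/-- **Removed pairs, finite form (upper).**  `Σ_r n_r g(γ_r, t) ≤ t²·Σ_{γ_r t ≤ 1} n_r + 4·Σ_{γ_r t > 1} n_r/γ_r²`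
(`g ≤ t²` below the resolution height, `g ≤ 4/γ²` above it). -/
theorem sum_removed_le (s : Finset ι) (n γ : ι → ℝ) (t : ℝ) (hn : ∀ r ∈ s, 0 ≤ n r)
    (hγ : ∀ r ∈ s, 0 < γ r) :
    ∑ r ∈ s, n r * pairTrace (γ r) t ≤
      t ^ 2 * ∑ r ∈ s with γ r * t ≤ 1, n r + 4 * ∑ r ∈ s with ¬ γ r * t ≤ 1, n r / γ r ^ 2 := by
  have key : ∀ r ∈ s, n r * pairTrace (γ r) t ≤
      if γ r * t ≤ 1 then t ^ 2 * n r else 4 * (n r / γ r ^ 2) := by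
    intro r hr
    split_ifs with hlow
    · calc n r * pairTrace (γ r) t ≤ n r * t ^ 2 := by
            gcongr
            · exact hn r hr
            · exact pairTrace_le_sq (hγ r hr).ne' t
        _ = t ^ 2 * n r := by ring
    · calc n r * pairTrace (γ r) t ≤ n r * (4 / γ r ^ 2) := by
            gcongr
            · exact hn r hr
            · exact pairTrace_le_four_div (γ r) t
        _ = 4 * (n r / γ r ^ 2) := by ring
  calc ∑ r ∈ s, n r * pairTrace (γ r) t
      ≤ ∑ r ∈ s, (if γ r * t ≤ 1 then t ^ 2 * n r else 4 * (n r / γ r ^ 2)) := Finset.sum_le_sum key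
    _ = t ^ 2 * ∑ r ∈ s with γ r * t ≤ 1, n r + 4 * ∑ r ∈ s with ¬ γ r * t ≤ 1, n r / γ r ^ 2 := by
        rw [Finset.sum_ite, Finset.mul_sum, Finset.mul_sum]

/-- **Removed pairs, finite form (lower).**  `Σ_r n_r g(γ_r, t) ≥ (11/12)·t²·Σ_{γ_r t ≤ 1} n_r`
(`g ≥ t² - γ²t⁴/12 ≥ (11/12)t²` below the resolution height, `g ≥ 0` above it). -/
theorem sum_removed_ge (s : Finset ι) (n γ : ι → ℝ) {t : ℝ} (ht : 0 ≤ t) (hn : ∀ r ∈ s, 0 ≤ n r)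
    (hγ : ∀ r ∈ s, 0 < γ r) :
    11 / 12 * t ^ 2 * ∑ r ∈ s with γ r * t ≤ 1, n r ≤ ∑ r ∈ s, n r * pairTrace (γ r) t := by
  have key : ∀ r ∈ s, (if γ r * t ≤ 1 then 11 / 12 * t ^ 2 * n r else 0) ≤ n r * pairTrace (γ r) t := by
    intro r hr
    split_ifs with hlow
    · have hg := sq_sub_le_pairTrace (hγ r hr).ne' t
      have hx : (γ r * t) ^ 2 ≤ 1 := pow_le_one₀ (mul_nonneg (hγ r hr).le ht) hlow
      have h11 : 11 / 12 * t ^ 2 ≤ pairTrace (γ r) t := by nlinarith [hg, hx, sq_nonneg t]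
      calc 11 / 12 * t ^ 2 * n r = n r * (11 / 12 * t ^ 2) := by ring
        _ ≤ n r * pairTrace (γ r) t := by gcongr; exact hn r hr
    · exact mul_nonneg (hn r hr) (pairTrace_nonneg _ _)
  calc 11 / 12 * t ^ 2 * ∑ r ∈ s with γ r * t ≤ 1, n r
      = ∑ r ∈ s, (if γ r * t ≤ 1 then 11 / 12 * t ^ 2 * n r else 0) := by
        rw [Finset.sum_ite, Finset.sum_const_zero, add_zero, Finset.mul_sum]
    _ ≤ ∑ r ∈ s, n r * pairTrace (γ r) t := Finset.sum_le_sum key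

end finite

/-! ## 6. The abstract COUNT THEFT LAW (pure real bookkeeping at `t = 1/Y`) -/

/-- **COUNT THEFT LAW (abstract form of theory-1's (G3)).**  Suppose on a germ window `(0, δ]`:
(G1) the tower trace dominates its unresolved count, `L·t²·N(1/t) - C·t² ≤ Ψ_Z(t)`;
(G2) the slides are small, `|S(t)| ≤ K·η̄·t²·log(1/t)`;
(R)  the removed mass is at most its unresolved count, `Rm(t) ≤ t²·R(1/t) + D·t²`;
and the exact theft identity `S(t) - Rm(t) = -Ψ_Z(t)` holds there.  Then for every height `Y ≥ 1/δ`: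
`L·N(Y) ≤ R(Y) + K·η̄·log Y + C + D` — below every height the stolen count must match the tower count. -/
theorem count_theft_law {L C K D ηbar δ : ℝ} {N R Ψ S Rm : ℝ → ℝ} (hδ : 0 < δ)
    (hG1 : ∀ t ∈ Set.Ioc 0 δ, L * t ^ 2 * N (1 / t) - C * t ^ 2 ≤ Ψ t)
    (hG2 : ∀ t ∈ Set.Ioc 0 δ, |S t| ≤ K * ηbar * t ^ 2 * Real.log (1 / t))
    (hR : ∀ t ∈ Set.Ioc 0 δ, Rm t ≤ t ^ 2 * R (1 / t) + D * t ^ 2)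
    (hid : ∀ t ∈ Set.Ioc 0 δ, S t - Rm t = -Ψ t) {Y : ℝ} (hY : 1 / δ ≤ Y) :
    L * N Y ≤ R Y + K * ηbar * Real.log Y + C + D := by
  have hYpos : 0 < Y := lt_of_lt_of_le (by positivity) hY
  set t := 1 / Y with ht
  have htpos : 0 < t := by positivity
  have htδ : t ≤ δ := by
    rw [ht]
    calc 1 / Y ≤ 1 / (1 / δ) := one_div_le_one_div_of_le (by positivity) hY
      _ = δ := one_div_one_div δ
  have hmem : t ∈ Set.Ioc 0 δ := ⟨htpos, htδ⟩
  have hYt : 1 / t = Y := by rw [ht, one_div_one_div]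
  have h1 := hG1 t hmem
  have h2 := hG2 t hmem
  have h3 := hR t hmem
  have h4 := hid t hmem
  rw [hYt] at h1 h2 h3
  have hS := (abs_le.mp h2).1
  -- `Ψ t = Rm t - S t ≤ t² R Y + D t² + K η̄ t² log Y` and `Ψ t ≥ L t² N Y - C t²`
  have hmain : L * t ^ 2 * N Y - C * t ^ 2 ≤ t ^ 2 * R Y + D * t ^ 2 + K * ηbar * t ^ 2 * Real.log Y := by
    linarith
  have ht2 : 0 < t ^ 2 := by positivity
  have := div_le_div_of_nonneg_right hmain ht2.le
  have lhs : (L * t ^ 2 * N Y - C * t ^ 2) / t ^ 2 = L * N Y - C := by field_simp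
  have rhs : (t ^ 2 * R Y + D * t ^ 2 + K * ηbar * t ^ 2 * Real.log Y) / t ^ 2 =
      R Y + D + K * ηbar * Real.log Y := by field_simp
  rw [lhs, rhs] at this
  linarith

/-- **PURE BOUNDED SLIDING HIDES NO SUPER-LOGARITHMIC TOWER.**  With no removal (`Rm = 0`) the law reads
`L·N(Y) ≤ K·η̄·log Y + C` for all `Y ≥ 1/δ`; hence if `L > 0` the unresolved tower count cannot satisfy
`N(Y)/log Y → ∞` (theory-1's corollary (c1), modulo the summed layer that supplies (G1) and (G2)). -/
theorem no_superlog_tower_of_pure_sliding {L C K ηbar δ : ℝ} {N Ψ S : ℝ → ℝ} (hL : 0 < L)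
    (hδ : 0 < δ)
    (hG1 : ∀ t ∈ Set.Ioc 0 δ, L * t ^ 2 * N (1 / t) - C * t ^ 2 ≤ Ψ t)
    (hG2 : ∀ t ∈ Set.Ioc 0 δ, |S t| ≤ K * ηbar * t ^ 2 * Real.log (1 / t))
    (hid : ∀ t ∈ Set.Ioc 0 δ, S t = -Ψ t)
    (hlim : Filter.Tendsto (fun Y ↦ N Y / Real.log Y) Filter.atTop Filter.atTop) : False := by
  -- the law with `R = 0`, `Rm = 0`, `D = 0`
  have hlaw : ∀ Y, 1 / δ ≤ Y → L * N Y ≤ K * ηbar * Real.log Y + C := by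
    intro Y hY
    have := count_theft_law (N := N) (R := fun _ ↦ 0) (Ψ := Ψ) (S := S) (Rm := fun _ ↦ 0)
      (L := L) (C := C) (K := K) (D := 0) (ηbar := ηbar) hδ hG1 hG2
      (fun t _ ↦ by simp) (fun t ht ↦ by simpa using hid t ht) hY
    simpa using this
  -- along `Y → ∞`: `N Y / log Y ≤ (K η̄ log Y + C)/(L log Y)` stays bounded, contradiction
  have hev : ∀ᶠ Y in Filter.atTop, N Y / Real.log Y ≤ (K * ηbar + |C|) / L := by
    filter_upwards [Filter.eventually_ge_atTop (max (1 / δ) (Real.exp 1))] with Y hY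
    have hY1 : 1 / δ ≤ Y := le_trans (le_max_left _ _) hY
    have hYe : Real.exp 1 ≤ Y := le_trans (le_max_right _ _) hY
    have hlog : 1 ≤ Real.log Y := by
      rw [← Real.log_exp 1]
      exact Real.log_le_log (Real.exp_pos 1) hYe
    have hlogpos : 0 < Real.log Y := by linarith
    rw [div_le_div_iff₀ hlogpos hL]
    have h := hlaw Y hY1
    have hC : C ≤ |C| * Real.log Y := by
      calc C ≤ |C| := le_abs_self C
        _ = |C| * 1 := by ring
        _ ≤ |C| * Real.log Y := by gcongr
    nlinarith [h, hC]
  have := (hlim.eventually (Filter.eventually_gt_atTop ((K * ηbar + |C|) / L))).and hev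
  obtain ⟨Y, hgt, hle⟩ := this.exists
  exact absurd hle (not_le.mpr hgt)

end Summit.RiemannHypothesis.RiemannHypothesis.Theorems.Splittings.SlidingGerm
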